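import Summits.ResolutionOfSingularities.ResolutionOfSingularities.Theorems.DeltaCutChain3
import Mathlib.CategoryTheory.CofilteredSystem
import Mathlib.CategoryTheory.Functor.OfSequence
import HarnessLib

/-!
# DeltaCutRun — decomp-res node «RunCut» (lens-6 g25, critic row 190 CLEARED +1), tree file 1/7 of the node

Content VERBATIM from the decomp-res lens-6 g25 node `HOME/decomp-res-lens-6/g25/RunCut.lean` (pin e4e94516, 2653 l;
HOME = run/shared/lean/pub/decomp-res), its NEW part l. 1187–2651 only: the node CARRIED g24 «ChainCut» l. 89–1165
byte-identically between `BEGIN/END CARRY g24` markers because g24 was not yet in the tree — that carry is DROPPED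
here and replaced by `import …Theorems.DeltaCutChain3` (g24 (A), landed as `DeltaCutChain` / `DeltaCutChain2` /
`DeltaCutChain3`) and, for the certificates, `…Theorems.DeltaCutChainCertificates2` (g24 (B)); every declaration
below is new, same namespace `…Theorems.DeltaCutClasses`.  Farm (node, lens + critic runs): rc 0 · 0 err · 0 warn ·
0 sorry · axioms std.  Critic: CRITIC-LEDGER row 190 CLEARED +1 (THE WHOLE-KIND LAW OF THE CHAIN AXIS by ITERATION +
KÖNIG: `E1TopChainHeavy ⟺ E1TopRunHeavy [RESIDUAL] ∧ E1TopChainHeavyRunTame [DECIDED from E 5]`, hypothesis-free and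
exact; D2 certifies the cut STRICT).  Landing orders = the lens's plan `HOME/decomp-res-lens-6/g25/NEXT-g26.md`
(bfe16773) §4 endorsed by the critic rider INBOX :1047: (A) `DeltaCutRun` = §RunDefs + §RunLaw + §RunKonig +
§RunCells + §RunEngine + §RunExactness, (B) `DeltaCutRunJunction` = §RunJunction, (C) `DeltaCutRunCertificates` =
§RunCertificates; all VERBATIM, `--kind proof --supports stmt-ResolutionOfSingularities-26971`; the `def … : Prop`
letters / cells (`BadFinite`, `BadEmpty`, `RunTerminates`, `RunInfiniteLevel`, `RunPerpetual`,
`WORTopChainHeavyRunTame`, `WORTopRunHeavy`, `E1TopChainHeavyRunTame`, `E1TopRunHeavy`, `WORTopRunInfiniteLevel`,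
`WORTopRunPerpetual`, `E1TopRunInfiniteLevel`, `E1TopRunPerpetual`) are THIS node's cells (cn26), the `Set`-valued
loci and the run data (`Stage`, `Hop`, `hop`, `badCentre`, `run`, `runHom`, `BadAt`, `badMap`, `badSystem`,
`BadThread`) are its objects — none is a vendored fact.  Aside bookkeeping (rider): exactly ONE live aside on the
lens-6 column — `E1TopRunHeavy` (home `DeltaCutRun`) SUPERSEDES the g23 aside `DCE1TopDeltaHeavy` (item 28044)
DIRECTLY (the intermediate g24 residual `E1TopChainHeavy` is landed but never filed as an aside, per the critic:
switch once); re-location theorem `e1TopChainHeavy_iff_e1TopRunHeavy (h5 : E 5)` ∘ g24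
`e1TopDeltaHeavy_iff_e1TopChainHeavy (h5 : E 5)`.

The lens header, verbatim:

> # RunCut (decomp-res-lens-6 · g25 · axis (S∞) of CRITIC-LEDGER row 185 / INBOX :1000): THE WHOLE-KIND LAW OF THE CHAIN AXIS
>
> NODE «RunCut».  Target = the column's located residual after g24, `DeltaCutClasses.E1TopChainHeavy` («at some level:
> infinitely many bad points, or a bad point with a WILD δ-heavy near point»; item stmt-…-26971, route MaxContactCut).
> CARRIED VERBATIM (g24's «ChainCut» is CLEARED, row 185, but NOT YET LANDED by writer-1): the block between the markers
> `-- BEGIN CARRY g24` / `-- END CARRY g24` below is `HOME/decomp-res-lens-6/g24/ChainCut.lean` sha256 dd25c369… l.89–1165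
> BYTE-IDENTICAL (its §ChainDefs … §ChainCertificates; priced 0 here).  Once `Theorems/DeltaCutChain.lean` +
> `Theorems/DeltaCutChainCertificates.lean` land, REV 2 = delete the carry and import those two files (nothing else changes).
> Everything AFTER `-- END CARRY g24` is NEW (sections `RunDefs`, `RunLaw`, `RunKonig`, `RunCells`, `RunEngine`, `RunExactness`,
> `RunJunction`, `RunCertificates`; same namespace `…Theorems.DeltaCutClasses`).
>
> THESIS of the cut (rule (C), port-free, ONE located cut = the WHOLE-KIND law of the chain axis by ITERATION + KÖNIG).
> g24 read the δ-law (N) at the near points of the finitely many BAD points (wild closed top points having a near point) ONE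
> blow-up deep.  (S∞) reads it at EVERY depth along the CANONICAL BAD RUN of the datum:
> * OBJECT (canonical, choice-free, pure blow-up data — no `g`, no port, no lens-4 class): `run n (Y, 𝓘) : ℕ → Stage`,
>   `Stage = (Y, 𝓘)`; the HOP of a stage blows up the REDUCED finite bad locus `𝓘(bad)` (a regular centre of closed points)
>   and passes to the controlled transform `(π^*𝓘 : 𝓔ⁿ)`; on a stage whose bad locus is INFINITE the run STAYS (identity hop).
>   `run` is `Nat.rec` (so `run (i+1)` is `(hop (run i)).next` definitionally and the hop morphisms `runHom i : (run (i+1)).Y ⟶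
>   (run i).Y` typecheck); `run_succ_front : run N (i+1) = run (hop N).next i`.
> * LETTERS (typed, DISJOINT, EXHAUSTIVE — `run_trichotomy`, exclusivity `RunInfiniteLevel → ¬RunTerminates` etc.):
>   `RunTerminates`   — some level has EMPTY bad locus, all earlier levels finite            [DECIDED];
>   `RunInfiniteLevel` — some level has INFINITE bad locus, all earlier levels finite        [RESIDUAL kind A];
>   `RunPerpetual`     — every level has a FINITE NONEMPTY bad locus                          [RESIDUAL kind B];
>   LEMMA A (`hop_base_mem_badLocus`, `runHom_base_mem`): the hop maps bad_{i+1} INTO bad_i (blow-up case: off the centre by the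
>   g23 off-centre transports of closedness/order/absolute contact/δ-lightness; over the centre trivially) — so an EMPTY level
>   stays empty (`badEmpty_run_of_le`), which is the exclusivity of the trichotomy.
> * KÖNIG IN KERNEL, both directions (`runPerpetual_iff_thread`): `RunPerpetual ⟺ (every level finite) ∧ ∃ BAD THREAD`
>   (`BadThread`: `y_i ∈ bad_i`, `runHom i (y_{i+1}) = y_i` — an INFINITE wild δ-heavy near-point chain through the run), by
>   Mathlib's `nonempty_sections_of_finite_inverse_system` applied to the inverse system `CategoryTheory.Functor.ofOpSequence`
>   of the finite nonempty bad loci (maps = LEMMA A; `Functor.ofOpSequence_map_homOfLE_succ`).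
> * THE ENGINE ITERATED IN KERNEL, ONE theorem for ALL heights (`wor_of_runTerminates (hn) (h5 : SeqDimFour 5 n)`): induction on
>   the termination height generalising the stage: blow up the finite bad locus (regular centre inside the top locus —
>   `isRegular_subscheme_vanishingIdeal_finset`, weakly admissible; base and `n`-datum upstairs by `baseStable_holds`,
>   `isDatum_transform_blowup`), observe that the run of the transformed datum IS the tail of the run (`run_succ_front` + the
>   stage identity `hop_next_of_finite`), recurse, splice the centre in front (`CentreSeq.cons`); at the EMPTY level every wild
>   closed top point is δ-light and g23's closing law `wor_of_splitOrLightOrDeltaLight` finishes.  NO per-height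
lemma is an item.
> * EXACT CARVE (hyp-free, excluded middle on `RunTerminates`): `WORTopChainHeavy n ⟺ WORTopRunHeavy n [RESIDUAL] ∧
>   WORTopChainHeavyRunTame n [DECIDED]`, families `E1TopChainHeavy ⟺ E1TopRunHeavy ∧ E1TopChainHeavyRunTame`; the decided
>   family is PROVED from `E 5` (`e1TopChainHeavyRunTame_of_five`), so the residual is RE-LOCATED EXACTLY BY NAME:
>   `e1TopChainHeavy_iff_e1TopRunHeavy (h5 : E 5)`; edges through the TREE names unchanged: `e1TopDeltaHeavy_iff_e1TopRunHeavy`,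
>   `e1TopHeavy_iff_e1TopRunHeavy`, `e1TopNoAbs_iff_e1TopRunHeavy (hSC) (h5)`, `e_one_iff_e1TopRunHeavy (hSC) (h5)`.
> * EXACTNESS of the residual (hyp-free over locally Noetherian stages, so over all base data):
>   `not_runTerminates_iff_infiniteLevel_or_thread : ¬RunTerminates ⟺ RunInfiniteLevel ∨ ((∀ i, finite) ∧ Nonempty BadThread)`;
>   the two HYP-FREE INCLUSIONS placing the cut inside g24: `badEmpty_hop_of_chainTame` / `runTerminates_of_not_topChainHeavy`
>   (g24-decided ⊆ run-decided: finite bad set with chain-light points ⟹ the run terminates at height ≤ 1) and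
>   `topChainHeavy_of_not_runTerminates` (run-residual ⊆ `TopChainHeavy`); the residual cell's INTRINSIC reading
>   `worTopRunHeavy_iff_intrinsic : WORTopRunHeavy n ⟺ «every base n-datum whose canonical bad run does not terminate has a weak
>   resolution»`; kind sub-cells `WORTopRunInfiniteLevel n` (A) / `WORTopRunPerpetual n` (B), disjoint, carve
>   `worTopRunHeavy_iff_infiniteLevel_perpetual`.
> * JUNCTION with lens-4 (0-weight BY NAME, no tower class re-typed): port-free `tower_stage_not_chainLightAt` (every stage of a
>   forced tower over base data whose next marked point is wild is CHAIN-HEAVY in g24's sense; `_of_pPowerTower`),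
and modulo the
>   tree port `TowerObstructs n`: `noTowerWild_of_worTopRunHeavy` (`WORTopRunHeavy n → SeqDimFour 5 n → NoTowerWild n P`, every
>   `P ≤ PPowerTower n`, via g23 `noTowerWild_of_worTopDeltaHeavy`).  At rd 3 lens-4 g32's Law A
>   `HugValuationCut.noTower_threefold_not_tauOne` + the g31 port already kill ISOLATED principal threads (cited,
0); our threads
>   need not be isolated in the top locus and our data are rd-4 hypersurface-order data of `E 1`.
> * CERTIFIED INHABITANTS (char 3, `n = 3`, g23/g24 polynomial format, LEVEL-INDEXED): DECIDED-NEW — D2 = `z³ + tu³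
+ u⁴ + w⁴ + t⁷`
>   has run height EXACTLY 2 (`D2_runHeightTwo_certificate`: level 0 bad = {origin}; level 1 bad = {y₁ = chart-t origin}, wild
>   with a near point; level 2: EVERY order-3 point over `y₁` is TAME, bad = ∅) — so D2 is g24-RESIDUAL (finite-chain kind: its
>   bad point has the wild δ-heavy near point `y₁`) and g25-DECIDED: the cut is STRICT; kind A — C_ax = `z³+t⁴+u⁴` at level
>   `i = 0` (`Cax_runInfiniteLevel_zero_certificate` = g24's `Cax_curve_certificate` read with the level index) and
>   B_S = `z³+t⁷+u⁷+w⁷` at level `i = 1` (`BS_runInfiniteLevel_one_certificate`: level 0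
>   bad = {origin}; on chart t the whole exceptional SURFACE `z′ = t = 0` consists of bad points: `f′ ∈ P³`, `P =
(z′,t) ∌ u′, w′`,
>   `3`-power form `z′³ + P⁴`, near point over every closed point of the surface); kind B (perpetual) — NO inhabitant is claimed
>   (ruling INBOX :1000 (vi): must-fail probes + the finite prefix of D2 + the honest tag EXPECTED-EMPTY / BARRIER-adjacent).
> FAMILY RULE (cn28, stated): (S∞) is the LAST +1 obtainable on the chain axis by iteration; height-k cells, level re-indexings,
> König variants, run-vs-tower dictionaries, transfinite re-sortings = 0 forever; the next +1 on this sub-column is a law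
> ELIMINATING kind A whole (curve/surface-centre law) or kind B whole (an invariant / obstruction THEOREM), or (T2′)
| (ρ), or the
> closing law of the then residual.
>
> PORTS/TREE NAMES USED: g23 `wor_of_splitOrLightOrDeltaLight`, `deltaLightAt_transform_iff_of_not_mem`,
> `isAbsContactAt_transform_iff_of_not_mem`, `topHeavy_of_topDeltaHeavy`, `noTowerWild_of_worTopDeltaHeavy`,
> `tower_stage_not_deltaLightAt`; tree `TwistCutClasses.baseStable_holds`, `HugValuationCut.tower_isDatum`, `tower_mult_eq`,
> `idealOrder_pt_eq_of_isDatum`, `not_isAbsContactAt_of_pPowerFormAt`, `charP_stalk_stage`; Literature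
> `IsBlowup.idealOrder_controlledTransform_of_not_mem`, `IsBlowup.isProper`, `IsBlowup.isLocallyNoetherian`, `blowup.isBlowup`,
> `coe_support_vanishingIdeal`; Mathlib `nonempty_sections_of_finite_inverse_system`, `CategoryTheory.Functor.ofOpSequence`,
> `Functor.ofOpSequence_map_homOfLE_succ`; g24 (carried) `isRegular_subscheme_vanishingIdeal_finset`,
`isDatum_transform_blowup`,
> `isClosed_of_finite_of_isClosed_singleton`, `deltaLightAt_of_chainLightAt_fac`, `topDeltaHeavy_of_topChainHeavy`,
certificates.
>
> Farm: `lean check` rc 0 · 0 errors · 0 warnings · 0 sorries; axioms {propext, Classical.choice, Quot.sound} (see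
`bc/Probe.lean`).
> No `instance`, no `notation`, no `sorry`.  All new `def`s are `Prop`-valued cells/letters, `Set`-valued loci, or the run data
> (`Stage`, `Hop`, `hop`, `badCentre`, `run`, `runHom`, `BadAt`, `badMap`, `badSystem`, `BadThread`) under `Theorems`.

## This file

§(S∞) THE RUN CUT of the chain-axis located residual `E1TopChainHeavy` (node l. 1187–1801): `section RunDefs` (the
CANONICAL BAD RUN of blow-up data — `Stage`, `Hop` / `hop` (blow up the reduced finite bad locus `badCentre`,
identity hop on an infinite bad locus), `run : ℕ → Stage` by `Nat.rec`, `runHom`, `run_succ_front`; letters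
`BadFinite` / `BadEmpty`), `section RunLaw` (LEMMA A `hop_base_mem_badLocus` / `runHom_base_mem`: the hop maps bad
points INTO bad points; the typed DISJOINT EXHAUSTIVE letters `RunTerminates` [DECIDED] / `RunInfiniteLevel`
[RESIDUAL kind A] / `RunPerpetual` [RESIDUAL kind B], `run_trichotomy`, exclusivity, `badEmpty_run_of_le`), `section
RunKonig` (KÖNIG IN KERNEL `runPerpetual_iff_thread` via Mathlib `nonempty_sections_of_finite_inverse_system` on
`Functor.ofOpSequence` of the finite bad loci; `BadAt` / `badMap` / `badSystem` / `BadThread`), `section RunCells`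
(the EXACT hypothesis-free carve `WORTopChainHeavy n ⟺ WORTopRunHeavy n [RESIDUAL] ∧ WORTopChainHeavyRunTame n
[DECIDED]`, families `E1TopChainHeavyRunTame` / **`E1TopRunHeavy`** — THE NEW LOCATED RESIDUAL of the lens-6 column,
the route aside's HOME is this file, cone-free — and the kind sub-cells `WORTopRunInfiniteLevel` /
`WORTopRunPerpetual` / `E1TopRunInfiniteLevel` / `E1TopRunPerpetual`), `section RunEngine` (THE ENGINE ITERATED IN
KERNEL, one theorem for all heights: `wor_of_runTerminates (hn) (h5 : SeqDimFour 5 n)`;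
`e1TopChainHeavyRunTame_of_five`; the exact re-location BY NAME `e1TopChainHeavy_iff_e1TopRunHeavy (h5 : E 5)` and
the edges `e1TopDeltaHeavy_iff_e1TopRunHeavy`, `e1TopHeavy_iff_e1TopRunHeavy`, `e1TopNoAbs_iff_e1TopRunHeavy`,
`e_one_iff_e1TopRunHeavy`), `section RunExactness` (`not_runTerminates_iff_infiniteLevel_or_thread`, the hyp-free
inclusions `runTerminates_of_not_topChainHeavy` / `topChainHeavy_of_not_runTerminates` placing the cut INSIDE g24,
`worTopRunHeavy_iff_intrinsic`, `worTopRunHeavy_iff_infiniteLevel_perpetual`) — continued in `DeltaCutRun2`… where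
the 400-line cap cuts.  (This first part carries: `Stage`, `Hop`, `BadFinite`, `BadEmpty`, `badCentre`,
`coe_support_badCentre`, `hop`, `run`, `run_zero`, `run_succ`, `runHom`, `run_succ_front`, `hop_next_of_finite`,
`hop_next_of_not_finite`, `hop_isLocallyNoetherian`, `run_isLocallyNoetherian`, `blowup_badCentre_base_mem`,
`hop_base_mem_badLocus`, `runHom_base_mem`, `badEmpty_hop_of_badEmpty`.)

[WRITER NOTE (decomp-res writer g12): file split only (tree files ≤ 400 lines); namespace, sections, section opens
and every declaration exactly as in the lens (the carry block and the node's global dupNamespace-linter line are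
dropped — the library sets the latter; the two namespace-level `open …TwistCutClasses` / `open …LightCutClasses`
lines of the node are replayed).]

(Sources: Hironaka1967 (characteristic polyhedra); CossartJannsenSaito2020 Def. 3.13 / Thm. 3.14, Ch. 8, Thm. 9.6;
Hironaka1970 (near points / vertices); CossartPiltant2019 Prop. 2.6; CossartPiltant2008 §2; Giraud1975; Hironaka2005
(three key theorems: order under permissible blow-up); König 1927 (Kőnig's lemma) as Mathlib
`nonempty_sections_of_finite_inverse_system`; EGAIV4 §16–§17; StacksProject 0804 / 0BIQ / 031I; Matsumura1987 §28.)
-/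

noncomputable section

open CategoryTheory CategoryTheory.Limits AlgebraicGeometry TopologicalSpace IsLocalRing
open Literature.AlgebraicGeometry.Resolution

universe u

namespace Summit.ResolutionOfSingularities.ResolutionOfSingularities.Theorems.DeltaCutClasses

open Summit.ResolutionOfSingularities.ResolutionOfSingularities.Theorems.TwistCutClasses
open Summit.ResolutionOfSingularities.ResolutionOfSingularities.Theorems.LightCutClasses

section RunDefs

open Summit.ResolutionOfSingularities.ResolutionOfSingularities.Theorems
open WeakOrderReduction ForcedTowerClasses SubfieldContactClasses AbsoluteContactClasses PurityValveClasses
open Scheme.IdealSheafData (vanishingIdeal)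

/-! ### §RunDefs — THE CANONICAL BAD RUN of blow-up data `(Y, 𝓘)` at marking `n` (object of the cut; canonical, choice-free) -/

/-- **A STAGE of a run**: a scheme with an ideal sheaf (pure blow-up data; the marking `n` is a parameter of the run, the base
field / structure morphism are NOT part of the object). DEFINITION (support). -/
structure Stage where
  /-- the ambient scheme of the stage -/
  Y : Scheme.{0}
  /-- the ideal of the stage -/
  I : Y.IdealSheafData

/-- **A HOP out of a stage**: the next stage with its structure morphism to the current one. DEFINITION (support). -/
structure Hop (N : Stage) where
  /-- the next stage -/
  next : Stage
  /-- the structure morphism of the hop -/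
  hom : next.Y ⟶ N.Y

/-- `BadFinite n N` — the bad locus `badLocus N.Y N.I n` (closed points of order `n`, no absolute stalk contact, NOT δ-light) of
the stage is FINITE. DEFINITION (letter). -/
def BadFinite (n : ℕ) (N : Stage) : Prop := (badLocus N.Y N.I n).Finite

/-- `BadEmpty n N` — the bad locus of the stage is EMPTY. DEFINITION (letter). -/
def BadEmpty (n : ℕ) (N : Stage) : Prop := badLocus N.Y N.I n = ∅

/-- **THE CENTRE OF THE HOP**: the REDUCED closed subscheme `𝓘(bad)` of the finite bad locus (a finite set of closed points is
closed, `isClosed_of_finite_of_isClosed_singleton`). DEFINITION (support). -/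
def badCentre (n : ℕ) (N : Stage) (h : BadFinite n N) : N.Y.IdealSheafData :=
  vanishingIdeal ⟨badLocus N.Y N.I n, isClosed_of_finite_of_isClosed_singleton h fun _ hy => hy.1⟩

/-- the centre of the hop is supported exactly on the bad locus. [folklore] -/
theorem coe_support_badCentre (n : ℕ) (N : Stage) (h : BadFinite n N) :
    ((badCentre n N h).support : Set N.Y) = badLocus N.Y N.I n :=
  coe_support_vanishingIdeal _

open Classical in
/-- **THE HOP of a stage at marking `n`** (canonical, choice-free): if the bad locus is FINITE, blow up its reduced structure
`𝓘(bad)` (`Literature…blowup`) and pass to the controlled transform `(π^*𝓘 : 𝓔ⁿ)`; if it is INFINITE, STAY (identity hop — the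
run is then frozen at a level of kind A). DEFINITION (the step of the run). -/
def hop (n : ℕ) (N : Stage) : Hop N :=
  if h : BadFinite n N then
    { next := ⟨blowup (badCentre n N h), controlledTransform (blowup.π (badCentre n N h)) (badCentre n N h) N.I n⟩
      hom := blowup.π (badCentre n N h) }
  else { next := N, hom := 𝟙 N.Y }

/-- **THE CANONICAL BAD RUN** `run n N : ℕ → Stage` — iterate the hop (`Nat.rec`, END-iteration, so that `run n N (i+1)` is
DEFINITIONALLY `(hop n (run n N i)).next` and the hop morphisms between consecutive levels typecheck). DEFINITION
(the object). -/
def run (n : ℕ) (N : Stage) : ℕ → Stage := fun i => Nat.rec N (fun _ P => (hop n P).next) i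

/-- level `0` of the run is the stage itself. [folklore] -/
@[simp] theorem run_zero (n : ℕ) (N : Stage) : run n N 0 = N := rfl

/-- level `i+1` of the run is the hop of level `i`. [folklore] -/
theorem run_succ (n : ℕ) (N : Stage) (i : ℕ) : run n N (i + 1) = (hop n (run n N i)).next := rfl

/-- **THE HOP MORPHISMS OF THE RUN** `runHom n N i : (run (i+1)).Y ⟶ (run i).Y`. DEFINITION (support). -/
def runHom (n : ℕ) (N : Stage) (i : ℕ) : (run n N (i + 1)).Y ⟶ (run n N i).Y := (hop n (run n N i)).hom

/-- **THE RUN OF THE NEXT STAGE IS THE TAIL OF THE RUN** (`run N (i+1) = run (hop N).next i`; propositional). [folklore] -/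
theorem run_succ_front (n : ℕ) (N : Stage) : ∀ i : ℕ, run n N (i + 1) = run n (hop n N).next i
  | 0 => rfl
  | i + 1 => by
    show (hop n (run n N (i + 1))).next = (hop n (run n (hop n N).next i)).next
    rw [run_succ_front n N i]

/-- the hop of a stage with FINITE bad locus is the blow-up of the reduced bad locus with the controlled transform.
[folklore] -/
theorem hop_next_of_finite {n : ℕ} {N : Stage} (h : BadFinite n N) :
    (hop n N).next =
      ⟨blowup (badCentre n N h), controlledTransform (blowup.π (badCentre n N h)) (badCentre n N h) N.I n⟩ := by
  rw [hop, dif_pos h]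

/-- the hop of a stage with INFINITE bad locus stays. [folklore] -/
theorem hop_next_of_not_finite {n : ℕ} {N : Stage} (h : ¬ BadFinite n N) : (hop n N).next = N := by
  rw [hop, dif_neg h]

/-- the hop of a locally Noetherian stage is locally Noetherian (`IsBlowup.isLocallyNoetherian`). [folklore] -/
theorem hop_isLocallyNoetherian (n : ℕ) (N : Stage) [IsLocallyNoetherian N.Y] : IsLocallyNoetherian (hop n N).next.Y := by
  by_cases h : BadFinite n N
  · rw [hop_next_of_finite h]
    exact (blowup.isBlowup _).isLocallyNoetherian
  · rw [hop_next_of_not_finite h]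
    infer_instance

/-- every level of the run of a locally Noetherian stage is locally Noetherian. [folklore] -/
theorem run_isLocallyNoetherian (n : ℕ) (N : Stage) [IsLocallyNoetherian N.Y] : ∀ i : ℕ, IsLocallyNoetherian (run n N i).Y
  | 0 => ‹IsLocallyNoetherian N.Y›
  | i + 1 => by
    haveI := run_isLocallyNoetherian n N i
    exact hop_isLocallyNoetherian n (run n N i)

end RunDefs

section RunLaw

open Summit.ResolutionOfSingularities.ResolutionOfSingularities.Theorems
open WeakOrderReduction ForcedTowerClasses SubfieldContactClasses AbsoluteContactClasses PurityValveClasses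
open Scheme.IdealSheafData (vanishingIdeal)

/-! ### §RunLaw — LEMMA A (the hop maps bad points INTO bad points), the LETTERS of the run and their TRICHOTOMY -/

/-- **LEMMA A at an explicit hop.**  A bad point of `(Bl_{bad} Y, (π^*𝓘 : 𝓔ⁿ))` lies OVER a bad point of `(Y, 𝓘)`:
were its image
`π y′` off the centre `𝓘(bad)`, the blow-up would be a stalk isomorphism near `y′` and closedness
(`IsBlowup.isProper`), the order
(`IsBlowup.idealOrder_controlledTransform_of_not_mem`), absolute stalk contact (`isAbsContactAt_transform_iff_of_not_mem`) and
δ-lightness (`deltaLightAt_transform_iff_of_not_mem`) of `y′` would transport to `π y′`, making it bad — i.e. ON the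
centre. [new] [folklore] -/
theorem blowup_badCentre_base_mem (n : ℕ) (N : Stage) [IsLocallyNoetherian N.Y] (h : BadFinite n N)
    {y' : ↥(blowup (badCentre n N h))}
    (hy' : y' ∈ badLocus (blowup (badCentre n N h))
      (controlledTransform (blowup.π (badCentre n N h)) (badCentre n N h) N.I n) n) :
    (blowup.π (badCentre n N h)).base y' ∈ badLocus N.Y N.I n := by
  have hπ := blowup.isBlowup (badCentre n N h)
  by_contra hno
  have hy'C : (blowup.π (badCentre n N h)).base y' ∉ ((badCentre n N h).support : Set N.Y) := by
    rw [coe_support_badCentre]; exact hno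
  haveI := hπ.isProper
  refine hno ⟨?_, ?_, ?_, ?_⟩
  · have := (blowup.π (badCentre n N h)).isClosedMap _ hy'.1
    rwa [Set.image_singleton] at this
  · rw [← hπ.idealOrder_controlledTransform_of_not_mem N.I n hy'C]; exact hy'.2.1
  · exact fun ha => hy'.2.2.1 ((isAbsContactAt_transform_iff_of_not_mem hπ N.I n n hy'C).2 ha)
  · exact fun hd => hy'.2.2.2 ((deltaLightAt_transform_iff_of_not_mem hπ N.I n n hy'C).2 hd)

/-- **LEMMA A (the hop maps bad points INTO bad points)** — both branches of the hop: the blow-up branch by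
`blowup_badCentre_base_mem`, the stay branch trivially. [new] [folklore] -/
theorem hop_base_mem_badLocus (n : ℕ) (N : Stage) [IsLocallyNoetherian N.Y] :
    ∀ y' : ↥(hop n N).next.Y, y' ∈ badLocus (hop n N).next.Y (hop n N).next.I n →
      (hop n N).hom.base y' ∈ badLocus N.Y N.I n := by
  by_cases h : BadFinite n N
  · rw [hop, dif_pos h]
    intro y' hy'
    exact blowup_badCentre_base_mem n N h hy'
  · rw [hop, dif_neg h]
    intro y' hy'
    simpa using hy'

/-- **LEMMA A along the run**: `runHom i` maps `bad_{i+1}` into `bad_i`. [new] [folklore] -/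
theorem runHom_base_mem (n : ℕ) (N : Stage) [IsLocallyNoetherian N.Y] (i : ℕ) {y' : ↥(run n N (i + 1)).Y}
    (hy' : y' ∈ badLocus (run n N (i + 1)).Y (run n N (i + 1)).I n) :
    (runHom n N i).base y' ∈ badLocus (run n N i).Y (run n N i).I n := by
  haveI := run_isLocallyNoetherian n N i
  exact hop_base_mem_badLocus n (run n N i) y' hy'

/-- an EMPTY bad locus stays empty after the hop (LEMMA A). [new] [folklore] -/
theorem badEmpty_hop_of_badEmpty (n : ℕ) (N : Stage) [IsLocallyNoetherian N.Y] (h : BadEmpty n N) :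
    BadEmpty n (hop n N).next := by
  refine Set.eq_empty_iff_forall_notMem.2 fun y' hy' => ?_
  have hmem := hop_base_mem_badLocus n N y' hy'
  rw [show badLocus N.Y N.I n = ∅ from h] at hmem
  exact hmem

end RunLaw

end Summit.ResolutionOfSingularities.ResolutionOfSingularities.Theorems.DeltaCutClasses
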